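import Summits.HodgeConjecture.CorCM.MultiFieldWeilQuinticDisjoint
import Summits.HodgeConjecture.CorCM.MultiFieldWeilGaloisHeadlines
import Summits.HodgeConjecture.CorCM.MultiFieldWeilTwoSimpleThreefolds
import Mathlib.FieldTheory.PrimitiveElement
import HarnessLib

/-!
# MULTI-FIELD WEIL ENGINE — TWO `(2,3)`-FIVEFOLDS OVER NON-ISOMORPHIC DECIC CM FIELDS SHARING `k` (Galois or not): the Hodge conjecture for every
# product of copies of `E`, `F₀`, `F₁`, given ONLY Markman's hyperbolic-sixfold theorem — the joint hypothesis discharged by the quintic degree chase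

Cell `pub-hodgecm2` (COR-CM), seat b30 gen 32 (2026-08-24); count-neutral own lane MULTI-FIELD WEIL ENGINE (stem `MultiFieldWeil*`), sequel of
`CorCM/MultiFieldWeilQuinticDisjoint.lean` (the degree chase `finrank_adjoin_pair_eq_of_forall_not_mem`), `CorCM/MultiFieldWeilNonIsomorphicSextics.lean` (gen 31,
the cubic case) and `CorCM/MultiFieldWeilGaloisHeadlines.lean` (G2b, `hodgeConjectureFor_biproduct_comp_of_decics_of_finrank`).  Theorems only; no definition,
no named fact, no `sorry`.  HONEST FRAMING: conditional on the displayed Markman hyperbolic-sixfold binder only; `HC_CM` is NOT proved and not asserted.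

THE FIELD-THEORETIC LEMMA (§1, **`finrank_adjoin_pair_of_isEmpty_ringHom_five`**).  `k ⊂ K₀`, `k ⊂ K₁` number fields with `[K_j : k] = 5` and NO ring
homomorphism `K₁ → K₀`; `τ`, `s₀ ⊃ τ`, `s₁ ⊃ τ` complex embeddings.  Then `[ℚ(τk) · s₀(K₀) · s₁(K₁) : ℚ] = 25 [k : ℚ]`, i.e. `s₀(K₀)` and `s₁(K₁)` are
linearly disjoint over `τ(k)`.  Proof: with `M = ℚ(τk)`, `a = s₀ α`, `b = s₁ β` (`α`, `β` primitive elements; `M(a) = ℚ(s₀ K₀)`, `[M(a) : M] = [M(b) : M] = 5`)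
this is the quintic degree chase, whose hypothesis — no conjugate `y` of `b` inside any `M(x)`, `x` a conjugate of `a` — holds because such a `y` is transported
(`exists_root_mem_adjoin_of_root_mem_adjoin_conj`) to a root `s₀ γ₀ ∈ M(a) = s₀(K₀)` of the minimal polynomial `q` of `β` over `k`, so `q(γ₀) = 0` in `K₀` and
`K₁ = k(β) → K₀` (`IntermediateField.algHomAdjoinIntegralEquiv`), contradicting `Hom(K₁, K₀) = ∅`.  (Relative cubics: `finrank_adjoin_pair_of_isEmpty_ringHom`;
relative degree `7`: false.)

THE HEADLINE (§2, **`hodgeConjectureFor_biproduct_comp_of_two_decics_of_isEmpty`**).  `k = Kf i₀` imaginary quadratic with `E = A 0 ⊨ (k; {τ})`; two DECIC CM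
fields `K_m = Kf (is m) ⊇ im m (k)` (`m : Fin 2`), Galois or not, with `Hom(K₁, K₀) = ∅`; `F_m = A (m+1) ⊨ (K_m; Φ (m+1))` with exactly TWO members of `Φ (m+1)`
over `τ` (`k`-signature `(2,3)`: Weil-type CM fivefolds).  Then the Hodge conjecture holds for EVERY product of copies `⨁_j A (κ j)` — `E^a × F₀^b × F₁^c`, any
order — GIVEN ONLY `Markman2025_weilClasses_algebraic_hyperbolicSixfold`: the joint-transitivity hypothesis `hJ` of `hodgeConjectureFor_biproduct_comp_of_decics`
(T7) is discharged through G2b's degree form with the degree `50 = 2 · 25` of §1.  This removes the binder `hJ` ∕ `hH` of the gen-30 decic towers for `r = 2`.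

THE FOUR-FIELD HEADLINE (§3, **`hodgeConjectureFor_biproduct_comp_of_two_sextics_two_decics_of_isEmpty`**).  `E`, two `(1,2)`-threefolds `T₀, T₁` over
NON-ISOMORPHIC SEXTIC CM fields `∋ k` and two `(2,3)`-fivefolds `F₀, F₁` over NON-ISOMORPHIC DECIC CM fields `∋ k`: the Hodge conjecture for EVERY product of copies
`E^a × T₀^b × T₁^c × F₀^d × F₁^e`, GIVEN ONLY Markman's fourfold AND hyperbolic-sixfold theorems (G2b `hodgeConjectureFor_biproduct_comp_of_sexticsDecics_of_finrank`,
its two degree classes discharged by gen 31's cubic lemma `finrank_adjoin_pair_of_isEmpty_ringHom` — degree `18` — and §1 — degree `50`).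
§4 gives the `vec` form `hodgeConjectureFor_biproduct_comp_vec_of_two_decics_of_isEmpty` on `![E, F₀, F₁]` (types of `k`-signature `(2,3)` or `(3,2)`, normalised
by `exists_realisation_card_eq_two`).

[cite: Markman2025SecantWeil, Thm 1.5.1] [cite: Lang2002, V §1 Prop. 1.2, VI §1 Thm. 1.1, Cor. 1.6 and V §2 Thm. 2.8] [cite: Shimura1998, §18.2 Lemma (i)]

## References
* [Markman2025SecantWeil] E. Markman, *Rational Hodge classes of Weil type on abelian sixfolds …*, Thm 1.5.1 (the hyperbolic-sixfold theorem, displayed binder).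
  [Lang2002] S. Lang, *Algebra*, GTM 211, V §1 Prop. 1.2 (tower law), V §2 Thm. 2.8, VI §1 Thm. 1.1 and Cor. 1.6.  [Shimura1998] G. Shimura, *Abelian varieties with
  complex multiplication and modular functions*, §18.2 Lemma (i).
-/

noncomputable section

open CategoryTheory CategoryTheory.Limits NumberField IntermediateField Polynomial

namespace Summit.HodgeConjecture.CorCM.MultiFieldWeil

open Finset
open Literature.AlgebraicGeometry Literature.AlgebraicGeometry.Motives Literature.AlgebraicGeometry.HodgeTheory
open Literature.AlgebraicGeometry.ComplexMultiplication (IsCMTypeRealisation)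
open Literature.AlgebraicTopology.SingularHomology
open Literature.NumberTheory.ComplexMultiplication

open scoped Classical

/-! ## §1 The number-field form: two extensions of relative degree `5` without homomorphisms between them are linearly disjoint -/

section Quintic

variable {k K₀ K₁ : Type} [Field k] [NumberField k] [Field K₀] [NumberField K₀] [Field K₁] [NumberField K₁]

/-- The image of an embedding of a number field `K` with primitive element `α` lies in `ℚ(s α)`. [folklore] -/
theorem range_subset_adjoin_of_primitive {K : Type} [Field K] [NumberField K] {α : K} (hα : ℚ⟮α⟯ = ⊤) (s : K →+* ℂ) :
    Set.range s ⊆ (ℚ⟮s α⟯ : IntermediateField ℚ ℂ) := by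
  rintro y ⟨x, rfl⟩
  have hx : x ∈ ℚ⟮α⟯ := by rw [hα]; exact mem_top
  have h : s.toRatAlgHom x ∈ (ℚ⟮α⟯).map s.toRatAlgHom := (IntermediateField.map_mem_map ℚ⟮α⟯ s.toRatAlgHom).2 hx
  rwa [IntermediateField.adjoin_map, Set.image_singleton] at h

/-- **TWO RELATIVE QUINTICS WITHOUT HOMOMORPHISMS ARE LINEARLY DISJOINT.**  `i_j : k → K_j` with `[K_j : ℚ] = 5 [k : ℚ]`, `Hom(K₁, K₀) = ∅`;
`s_j : K_j → ℂ` complex embeddings over `τ : k → ℂ`.  Then the subfield `ℚ(τk) ⊔ ℚ(s₀(K₀) ∪ s₁(K₁))` of `ℂ` has degree `25 [k : ℚ]` over `ℚ`, i.e.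
`s₀(K₀)` and `s₁(K₁)` are linearly disjoint over `τ(k)`.  With `M = τ(k)`, `a = s₀ α`, `b = s₁ β` (`α`, `β` primitive elements) this is
`finrank_adjoin_pair_eq_of_forall_not_mem`: a conjugate `y` of `b` inside some `M(x)`, `x` a conjugate of `a`, is transported to a root of the minimal
polynomial of `β` over `k` inside `M(a) = s₀(K₀)` (`exists_root_mem_adjoin_of_root_mem_adjoin_conj`), i.e. to a `k`-embedding `K₁ = k(β) → K₀`.  (For
relative CUBICS: `finrank_adjoin_pair_of_isEmpty_ringHom`; for relative degree `7` the statement is false.) [cite: Lang2002, V §1 Prop. 1.2, VI §1 Thm. 1.1, V §2 Thm. 2.8] -/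
theorem finrank_adjoin_pair_of_isEmpty_ringHom_five (i₀ : k →+* K₀) (i₁ : k →+* K₁) (h₀ : Module.finrank ℚ K₀ = 5 * Module.finrank ℚ k)
    (h₁ : Module.finrank ℚ K₁ = 5 * Module.finrank ℚ k) (hK : IsEmpty (K₁ →+* K₀)) {τ : k →+* ℂ} {s₀ : K₀ →+* ℂ} {s₁ : K₁ →+* ℂ}
    (hs₀ : s₀.comp i₀ = τ) (hs₁ : s₁.comp i₁ = τ) :
    Module.finrank ℚ ↥(adjoin ℚ (Set.range τ) ⊔ adjoin ℚ (Set.range s₀ ∪ Set.range s₁)) = 25 * Module.finrank ℚ k := by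
  letI : Algebra k K₀ := i₀.toAlgebra
  letI : Algebra k K₁ := i₁.toAlgebra
  haveI : IsScalarTower ℚ k K₁ := IsScalarTower.of_algebraMap_eq fun q => by
    rw [RingHom.algebraMap_toAlgebra, eq_ratCast, eq_ratCast, map_ratCast]
  haveI : FiniteDimensional k K₁ := FiniteDimensional.right ℚ k K₁
  have hk1 : Module.finrank k K₁ = 5 := by
    have h := Module.finrank_mul_finrank ℚ k K₁
    rw [h₁, mul_comm 5] at h
    exact Nat.eq_of_mul_eq_mul_left Module.finrank_pos h
  -- the base `M = ℚ(τ k) ⊂ ℂ`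
  set M : IntermediateField ℚ ℂ := adjoin ℚ (Set.range τ) with hMdef
  have hfinM : Module.finrank ℚ M = Module.finrank ℚ k := finrank_adjoin_range_ringHom τ
  haveI : FiniteDimensional ℚ M := Module.finite_of_finrank_pos (by rw [hfinM]; exact Module.finrank_pos)
  have hτM : ∀ x, τ x ∈ M := fun x => subset_adjoin ℚ _ ⟨x, rfl⟩
  let τM : k →+* M := τ.codRestrict M hτM
  have hτM_comp : (algebraMap M ℂ).comp τM = τ := RingHom.ext fun x => rfl
  -- primitive elements and their images `a = s₀ α`, `b = s₁ β`
  obtain ⟨α, hα⟩ := Field.exists_primitive_element ℚ K₀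
  obtain ⟨β, hβ⟩ := Field.exists_primitive_element ℚ K₁
  set a : ℂ := s₀ α with hadef
  set b : ℂ := s₁ β with hbdef
  have hs₀a : Set.range s₀ ⊆ (ℚ⟮a⟯ : IntermediateField ℚ ℂ) := range_subset_adjoin_of_primitive hα s₀
  have hs₁b : Set.range s₁ ⊆ (ℚ⟮b⟯ : IntermediateField ℚ ℂ) := range_subset_adjoin_of_primitive hβ s₁
  have hτs₀ : ∀ x, τ x = s₀ (i₀ x) := fun x => by rw [← hs₀]; rfl
  have hτs₁ : ∀ x, τ x = s₁ (i₁ x) := fun x => by rw [← hs₁]; rfl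
  -- `M(a) = ℚ(s₀ K₀)` and `M(b) = ℚ(s₁ K₁)` as subfields of `ℂ`; the degrees `[M(a) : M] = [M(b) : M] = 5`
  have hMgen : ∀ {K : Type} [Field K] [NumberField K] (i : k →+* K) (s : K →+* ℂ) (c : ℂ), (∀ x, τ x = s (i x)) → c ∈ Set.range s →
      Set.range s ⊆ (ℚ⟮c⟯ : IntermediateField ℚ ℂ) → (M⟮c⟯).restrictScalars ℚ = adjoin ℚ (Set.range s) := by
    intro K _ _ i s c hτs hc hsc
    rw [show (M⟮c⟯).restrictScalars ℚ = M ⊔ ℚ⟮c⟯ from restrictScalars_adjoin_eq_sup ℚ M _]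
    refine le_antisymm (sup_le (adjoin.mono ℚ _ _ ?_) (adjoin.mono ℚ _ _ (Set.singleton_subset_iff.2 hc))) ?_
    · rintro y ⟨x, rfl⟩
      exact ⟨i x, (hτs x).symm⟩
    · exact le_sup_of_le_right (adjoin_le_iff.2 hsc)
  have hMa : (M⟮a⟯).restrictScalars ℚ = adjoin ℚ (Set.range s₀) := hMgen i₀ s₀ a hτs₀ ⟨α, rfl⟩ hs₀a
  have hMb : (M⟮b⟯).restrictScalars ℚ = adjoin ℚ (Set.range s₁) := hMgen i₁ s₁ b hτs₁ ⟨β, rfl⟩ hs₁b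
  have haint : IsIntegral M a := ((IsIntegral.of_finite ℚ α).map s₀.toRatAlgHom).tower_top
  have hbint : IsIntegral M b := ((IsIntegral.of_finite ℚ β).map s₁.toRatAlgHom).tower_top
  have hdeg5 : ∀ {K : Type} [Field K] [NumberField K] (s : K →+* ℂ) (c : ℂ), IsIntegral M c → Module.finrank ℚ K = 5 * Module.finrank ℚ k →
      (M⟮c⟯).restrictScalars ℚ = adjoin ℚ (Set.range s) → (minpoly M c).natDegree = 5 := by
    intro K _ _ s c hc hK hMc
    rw [← adjoin.finrank hc]
    have htower := Module.finrank_mul_finrank ℚ M ↥M⟮c⟯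
    have h1 : Module.finrank ℚ ↥M⟮c⟯ = Module.finrank ℚ ↥((M⟮c⟯).restrictScalars ℚ) := rfl
    rw [h1, hMc, finrank_adjoin_range_ringHom s, hK, hfinM, mul_comm 5] at htower
    exact Nat.eq_of_mul_eq_mul_left Module.finrank_pos htower
  have h5a : (minpoly M a).natDegree = 5 := hdeg5 s₀ a haint h₀ hMa
  have h5b : (minpoly M b).natDegree = 5 := hdeg5 s₁ b hbint h₁ hMb
  -- the minimal polynomial `q` of `β` over `k`, transported to `M`, vanishes at `b`; hence `minpoly M b ∣ q.map τM`
  have hβint : IsIntegral k β := IsIntegral.of_finite k β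
  have hβtop : k⟮β⟯ = ⊤ := by
    rw [eq_top_iff]
    intro x _
    have hx : x ∈ ℚ⟮β⟯ := by rw [hβ]; exact mem_top
    have hle : ℚ⟮β⟯ ≤ (k⟮β⟯).restrictScalars ℚ := adjoin_le_iff.2 (Set.singleton_subset_iff.2 (mem_adjoin_simple_self k β))
    exact hle hx
  set q : k[X] := minpoly k β with hq
  have hqb : aeval b (q.map τM) = 0 := by
    rw [aeval_def, eval₂_map, hτM_comp, ← hs₁, hbdef, ← Polynomial.hom_eval₂, ← RingHom.algebraMap_toAlgebra i₁, ← aeval_def, hq, minpoly.aeval,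
      map_zero]
  have hdvd : minpoly M b ∣ q.map τM := minpoly.dvd M b hqb
  -- NO conjugate of `b` lies in any `M(x)`, `x` a conjugate of `a`: transported to `M(a) = s₀(K₀)` it would be a root `s₀ γ₀` of `q`, `q(γ₀) = 0`,
  -- i.e. a `k`-embedding `K₁ = k(β) → K₀`
  have H : ∀ x y : ℂ, aeval x (minpoly M a) = 0 → aeval y (minpoly M b) = 0 → y ∉ M⟮x⟯ := by
    intro x y hx hy hyx
    obtain ⟨y', hy'g, hy'a⟩ := exists_root_mem_adjoin_of_root_mem_adjoin_conj haint hx hy hyx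
    have hy'q : aeval y' (q.map τM) = 0 := aeval_eq_zero_of_dvd_aeval_eq_zero hdvd hy'g
    have hy'A : y' ∈ s₀.toRatAlgHom.fieldRange := by
      rw [← adjoin_range_ringHom_eq_fieldRange, ← hMa, mem_restrictScalars]
      exact hy'a
    obtain ⟨γ₀, hγ₀⟩ := AlgHom.mem_fieldRange.1 hy'A
    have hroot : aeval γ₀ q = 0 := by
      apply s₀.injective
      rw [map_zero, aeval_def, RingHom.algebraMap_toAlgebra, Polynomial.hom_eval₂, hs₀, show s₀ γ₀ = y' from hγ₀]
      rw [aeval_def, eval₂_map, hτM_comp] at hy'q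
      exact hy'q
    have hmem : γ₀ ∈ (minpoly k β).aroots K₀ := by
      rw [mem_aroots]
      exact ⟨minpoly.ne_zero hβint, hroot⟩
    let φ : k⟮β⟯ →ₐ[k] K₀ := (algHomAdjoinIntegralEquiv k hβint).symm ⟨γ₀, hmem⟩
    let e : K₁ ≃ₐ[k] k⟮β⟯ := (IntermediateField.topEquiv.symm.trans (IntermediateField.equivOfEq hβtop.symm))
    exact hK.false (φ.toRingHom.comp e.toAlgHom.toRingHom)
  -- the quintic degree chase: `[M(a, b) : M] = 25`
  have h25 : Module.finrank M ↥M⟮a, b⟯ = 25 := finrank_adjoin_pair_eq_of_forall_not_mem haint hbint h5a h5b H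
  -- the compositum is `M(a, b)`
  have hF : adjoin ℚ (Set.range τ) ⊔ adjoin ℚ (Set.range s₀ ∪ Set.range s₁) = (M⟮a, b⟯).restrictScalars ℚ := by
    rw [show (M⟮a, b⟯).restrictScalars ℚ = M ⊔ adjoin ℚ {a, b} from restrictScalars_adjoin_eq_sup ℚ M _]
    refine le_antisymm (sup_le_sup_left (adjoin_le_iff.2 (Set.union_subset ?_ ?_)) M) (sup_le_sup_left (adjoin.mono ℚ _ _ ?_) M)
    · exact hs₀a.trans (adjoin.mono ℚ _ _ (Set.singleton_subset_iff.2 (Set.mem_insert a {b})))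
    · exact hs₁b.trans (adjoin.mono ℚ _ _ (Set.singleton_subset_iff.2 (Set.mem_insert_of_mem a (Set.mem_singleton b))))
    · exact Set.insert_subset (Set.mem_union_left _ ⟨α, rfl⟩) (Set.singleton_subset_iff.2 (Set.mem_union_right _ ⟨β, rfl⟩))
  have hfin : Module.finrank ℚ ↥((M⟮a, b⟯).restrictScalars ℚ) = Module.finrank ℚ ↥M⟮a, b⟯ := rfl
  rw [hF, hfin, ← Module.finrank_mul_finrank ℚ M ↥M⟮a, b⟯, h25, hfinM, mul_comm]

end Quintic

/-! ## §2 The headline for two non-isomorphic decic CM fields -/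

section Engine

variable {I : Type} {Kf : I → Type} [∀ i, Field (Kf i)] [∀ i, NumberField (Kf i)] [∀ i, IsCMField (Kf i)]
  {i₀ : I} {is : Fin 2 → I} {τ : Kf i₀ →+* ℂ}
  {A : Fin (2 + 1) → AbelianVariety ℂ} {Φ : ∀ j : Fin (2 + 1), CMType (Kf (mfSlots i₀ is j))}
  {ι : ∀ j, 𝓞 (Kf (mfSlots i₀ is j)) →+* End (A j)}
  {θ : ∀ j, Kf (mfSlots i₀ is j) →+* Module.End ℂ (complexBetti (A j).X 1)}

/-- **TWO `(2,3)`-FIVEFOLDS OVER NON-ISOMORPHIC DECIC CM FIELDS SHARING `k` — given ONLY Markman's hyperbolic-sixfold theorem.**  `k = Kf i₀` imaginary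
quadratic, `E = A 0 ⊨ (k; {τ})`; `K_m = Kf (is m)` (`m : Fin 2`) DECIC CM fields containing `k` via `im m`, with NO ring homomorphism `K₁ → K₀` (non-isomorphic;
Galois or not); `F_m = A (m+1) ⊨ (K_m; Φ (m+1))` with exactly two members of `Φ (m+1)` over `τ`.  Then the Hodge conjecture holds for EVERY product of copies
`⨁_j A (κ j)` (`E^a × F₀^b × F₁^c`, any number and order).  The joint-transitivity hypothesis `hJ` of `hodgeConjectureFor_biproduct_comp_of_decics` is discharged by
orbit counting in degree form (`hodgeConjectureFor_biproduct_comp_of_decics_of_finrank`) and `finrank_adjoin_pair_of_isEmpty_ringHom_five`.  `HC_CM` is NOT asserted.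
[cite: Markman2025SecantWeil, Thm 1.5.1] [cite: Lang2002, VI §1 Thm. 1.1, Cor. 1.6 and V §2 Thm. 2.8] [cite: Shimura1998, §18.2 Lemma (i)] -/
theorem hodgeConjectureFor_biproduct_comp_of_two_decics_of_isEmpty (hM6 : Markman2025_weilClasses_algebraic_hyperbolicSixfold)
    {N : ℕ} (κ : Fin N → Fin (2 + 1)) (h2 : Module.finrank ℚ (Kf i₀) = 2) (h10 : ∀ m : Fin 2, Module.finrank ℚ (Kf (is m)) = 10)
    (im : ∀ m : Fin 2, Kf i₀ →+* Kf (is m)) (hA : ∀ j, IsCMTypeRealisation (Φ j) (A j) (ι j) (θ j)) (hΨ : ∀ σ : Kf i₀ →+* ℂ, σ ∈ (Φ 0).1 ↔ σ = τ)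
    (h23 : ∀ m : Fin 2, (Finset.univ.filter fun s : Kf (is m) →+* ℂ => s.comp (im m) = τ ∧ s ∈ (Φ m.succ).1).card = 2)
    (hK : IsEmpty (Kf (is 1) →+* Kf (is 0))) :
    HodgeConjectureFor (⨁ fun j => A (κ j)).dim (⨁ fun j => A (κ j)).X := by
  have hex : ∀ m : Fin 2, ∃ s : Kf (is m) →+* ℂ, s.comp (im m) = τ := fun m => by
    have hc := SexticOcticWeil.card_filter_comp_eq_of_finrank (n := 5) (im m) (by rw [h10 m]) h2 τ
    obtain ⟨s, hs⟩ := Finset.card_pos.1 (by rw [hc]; norm_num)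
    exact ⟨s, (Finset.mem_filter.1 hs).2⟩
  choose s₀ hs₀ using hex
  refine hodgeConjectureFor_biproduct_comp_of_decics_of_finrank hM6 κ h2 h10 im hA hΨ h23 s₀ hs₀ ?_
  have hU : (⋃ m : Fin 2, Set.range (s₀ m)) = Set.range (s₀ 0) ∪ Set.range (s₀ 1) := by
    ext x
    simp only [Set.mem_iUnion, Set.mem_union, Fin.exists_fin_two]
  rw [hU, finrank_adjoin_pair_of_isEmpty_ringHom_five (im 0) (im 1) (by rw [h10 0, h2]) (by rw [h10 1, h2]) hK (hs₀ 0) (hs₀ 1), h2]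
  norm_num

/-- **Dominated form**: every abelian variety dominated by such a product of copies satisfies the Hodge conjecture (given Markman's hyperbolic-sixfold theorem).
[cite: Markman2025SecantWeil, Thm 1.5.1] -/
theorem hodgeConjectureFor_of_avDominatedBy_comp_of_two_decics_of_isEmpty (hM6 : Markman2025_weilClasses_algebraic_hyperbolicSixfold)
    {N : ℕ} (κ : Fin N → Fin (2 + 1)) (h2 : Module.finrank ℚ (Kf i₀) = 2) (h10 : ∀ m : Fin 2, Module.finrank ℚ (Kf (is m)) = 10)
    (im : ∀ m : Fin 2, Kf i₀ →+* Kf (is m)) (hA : ∀ j, IsCMTypeRealisation (Φ j) (A j) (ι j) (θ j)) (hΨ : ∀ σ : Kf i₀ →+* ℂ, σ ∈ (Φ 0).1 ↔ σ = τ)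
    (h23 : ∀ m : Fin 2, (Finset.univ.filter fun s : Kf (is m) →+* ℂ => s.comp (im m) = τ ∧ s ∈ (Φ m.succ).1).card = 2)
    (hK : IsEmpty (Kf (is 1) →+* Kf (is 0))) {X : AbelianVariety ℂ} (hX : Domination.AVDominatedBy X (⨁ fun j => A (κ j))) :
    HodgeConjectureFor X.dim X.X :=
  Domination.hodgeConjectureFor_of_avDominatedBy (hodgeConjectureFor_biproduct_comp_of_two_decics_of_isEmpty hM6 κ h2 h10 im hA hΨ h23 hK) hX

end Engine

/-! ## §3 Two non-isomorphic sextics AND two non-isomorphic decics together -/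

section Four

variable {I : Type} {Kf : I → Type} [∀ i, Field (Kf i)] [∀ i, NumberField (Kf i)] [∀ i, IsCMField (Kf i)]
  {i₀ : I} {is : Fin 4 → I} {τ : Kf i₀ →+* ℂ}
  {A : Fin (4 + 1) → AbelianVariety ℂ} {Φ : ∀ j : Fin (4 + 1), CMType (Kf (mfSlots i₀ is j))}
  {ι : ∀ j, 𝓞 (Kf (mfSlots i₀ is j)) →+* End (A j)}
  {θ : ∀ j, Kf (mfSlots i₀ is j) →+* Module.End ℂ (complexBetti (A j).X 1)}

/-- **TWO `(1,2)`-THREEFOLDS OVER NON-ISOMORPHIC SEXTICS AND TWO `(2,3)`-FIVEFOLDS OVER NON-ISOMORPHIC DECICS, ALL SHARING `k` — given ONLY Markman's two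
theorems.**  `E = A 0 ⊨ (k; {τ})`; `K_0, K_1` SEXTIC and `K_2, K_3` DECIC CM fields containing `k` (`im m`; degrees `[K_m : ℚ] = 2 · (3, 3, 5, 5)_m`), with
`Hom(K_1, K_0) = ∅` and `Hom(K_3, K_2) = ∅`; `A (m+1) ⊨ (K_m; Φ (m+1))` with `(1, 1, 2, 2)_m` members of the type over `τ`.  Then the Hodge conjecture holds for
EVERY product of copies `⨁_j A (κ j)` — `E^a × T₀^b × T₁^c × F₀^d × F₁^e` — GIVEN ONLY `Markman2025_weilClasses_algebraic_abelianFourfold` and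
`Markman2025_weilClasses_algebraic_hyperbolicSixfold`: G2b's `hodgeConjectureFor_biproduct_comp_of_sexticsDecics_of_finrank` with its two degree classes
discharged by `finrank_adjoin_pair_of_isEmpty_ringHom` (cubics, degree `18`) and `finrank_adjoin_pair_of_isEmpty_ringHom_five` (quintics, degree `50`).
`HC_CM` is NOT asserted. [cite: Markman2025SurveySecant, Thm. 1.2] [cite: Markman2025SecantWeil, Thm 1.5.1] [cite: Lang2002, VI §1 Thm. 1.1, Cor. 1.6 and V §2 Thm. 2.8] -/
theorem hodgeConjectureFor_biproduct_comp_of_two_sextics_two_decics_of_isEmpty (hW4 : Markman2025_weilClasses_algebraic_abelianFourfold)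
    (hM6 : Markman2025_weilClasses_algebraic_hyperbolicSixfold) {N : ℕ} (κ : Fin N → Fin (4 + 1)) (h2 : Module.finrank ℚ (Kf i₀) = 2)
    (hdeg : ∀ m : Fin 4, Module.finrank ℚ (Kf (is m)) = 2 * ![3, 3, 5, 5] m) (im : ∀ m : Fin 4, Kf i₀ →+* Kf (is m))
    (hA : ∀ j, IsCMTypeRealisation (Φ j) (A j) (ι j) (θ j)) (hΨ : ∀ σ : Kf i₀ →+* ℂ, σ ∈ (Φ 0).1 ↔ σ = τ)
    (hp : ∀ m : Fin 4, (Finset.univ.filter fun s : Kf (is m) →+* ℂ => s.comp (im m) = τ ∧ s ∈ (Φ m.succ).1).card = ![1, 1, 2, 2] m)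
    (hK₀₁ : IsEmpty (Kf (is 1) →+* Kf (is 0))) (hK₂₃ : IsEmpty (Kf (is 3) →+* Kf (is 2))) :
    HodgeConjectureFor (⨁ fun j => A (κ j)).dim (⨁ fun j => A (κ j)).X := by
  have hex : ∀ m : Fin 4, ∃ s : Kf (is m) →+* ℂ, s.comp (im m) = τ := fun m => by
    have hc := SexticOcticWeil.card_filter_comp_eq_of_finrank (n := ![3, 3, 5, 5] m) (im m) (hdeg m) h2 τ
    have hpos : 0 < ![3, 3, 5, 5] m := by fin_cases m <;> decide
    obtain ⟨s, hs⟩ := Finset.card_pos.1 (by rw [hc]; exact hpos)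
    exact ⟨s, (Finset.mem_filter.1 hs).2⟩
  choose s₀ hs₀ using hex
  refine hodgeConjectureFor_biproduct_comp_of_sexticsDecics_of_finrank hW4 hM6 (![3, 3, 5, 5]) (![1, 1, 2, 2]) (fun m => by fin_cases m <;> decide) κ h2
    hdeg im hA hΨ hp fun m₀ _ => ⟨s₀, fun m _ => hs₀ m, ?_⟩
  -- the two degree classes: the sextics `{0, 1}` (degree `18`) and the decics `{2, 3}` (degree `50`)
  have h18 : Module.finrank ℚ ↥(adjoin ℚ (Set.range τ) ⊔ adjoin ℚ (Set.range (s₀ 0) ∪ Set.range (s₀ 1))) = 18 := by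
    rw [finrank_adjoin_pair_of_isEmpty_ringHom (im 0) (im 1) (by rw [hdeg 0, h2]; decide) (by rw [hdeg 1, h2]; decide) hK₀₁ (hs₀ 0) (hs₀ 1), h2]
  have h50 : Module.finrank ℚ ↥(adjoin ℚ (Set.range τ) ⊔ adjoin ℚ (Set.range (s₀ 2) ∪ Set.range (s₀ 3))) = 50 := by
    rw [finrank_adjoin_pair_of_isEmpty_ringHom_five (im 2) (im 3) (by rw [hdeg 2, h2]; decide) (by rw [hdeg 3, h2]; decide) hK₂₃ (hs₀ 2) (hs₀ 3), h2]
  have hU3 : (![3, 3, 5, 5] : Fin 4 → ℕ) m₀ = 3 →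
      (⋃ (m : Fin 4) (_ : (![3, 3, 5, 5] : Fin 4 → ℕ) m = ![3, 3, 5, 5] m₀), Set.range (s₀ m)) = Set.range (s₀ 0) ∪ Set.range (s₀ 1) := by
    intro hm₀
    rw [hm₀]
    ext x
    simp only [Set.mem_iUnion, Set.mem_union, Set.mem_range, exists_prop]
    constructor
    · rintro ⟨m, hm, y, rfl⟩
      fin_cases m
      · exact Or.inl ⟨y, rfl⟩
      · exact Or.inr ⟨y, rfl⟩
      · exact absurd hm (by decide)
      · exact absurd hm (by decide)
    · rintro (⟨y, rfl⟩ | ⟨y, rfl⟩)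
      · exact ⟨0, by decide, y, rfl⟩
      · exact ⟨1, by decide, y, rfl⟩
  have hU5 : (![3, 3, 5, 5] : Fin 4 → ℕ) m₀ = 5 →
      (⋃ (m : Fin 4) (_ : (![3, 3, 5, 5] : Fin 4 → ℕ) m = ![3, 3, 5, 5] m₀), Set.range (s₀ m)) = Set.range (s₀ 2) ∪ Set.range (s₀ 3) := by
    intro hm₀
    rw [hm₀]
    ext x
    simp only [Set.mem_iUnion, Set.mem_union, Set.mem_range, exists_prop]
    constructor
    · rintro ⟨m, hm, y, rfl⟩
      fin_cases m
      · exact absurd hm (by decide)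
      · exact absurd hm (by decide)
      · exact Or.inl ⟨y, rfl⟩
      · exact Or.inr ⟨y, rfl⟩
    · rintro (⟨y, rfl⟩ | ⟨y, rfl⟩)
      · exact ⟨2, by decide, y, rfl⟩
      · exact ⟨3, by decide, y, rfl⟩
  have hP3 : (![3, 3, 5, 5] : Fin 4 → ℕ) m₀ = 3 →
      2 * (∏ m ∈ Finset.univ.filter (fun m => (![3, 3, 5, 5] : Fin 4 → ℕ) m = ![3, 3, 5, 5] m₀), (![3, 3, 5, 5] : Fin 4 → ℕ) m) = 18 := by
    intro hm₀
    rw [hm₀]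
    decide
  have hP5 : (![3, 3, 5, 5] : Fin 4 → ℕ) m₀ = 5 →
      2 * (∏ m ∈ Finset.univ.filter (fun m => (![3, 3, 5, 5] : Fin 4 → ℕ) m = ![3, 3, 5, 5] m₀), (![3, 3, 5, 5] : Fin 4 → ℕ) m) = 50 := by
    intro hm₀
    rw [hm₀]
    decide
  have hv : (![3, 3, 5, 5] : Fin 4 → ℕ) m₀ = 3 ∨ (![3, 3, 5, 5] : Fin 4 → ℕ) m₀ = 5 := by fin_cases m₀ <;> decide
  rcases hv with h | h
  · rw [hU3 h, hP3 h, h18]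
  · rw [hU5 h, hP5 h, h50]

end Four

/-! ## §4 `vec` form: `E`, `F₀`, `F₁` with fields `k`, `K₀`, `K₁` — Weil-type signature `(2,3)` up to conjugation, no hypothesis on the types beyond that -/

section Vec

variable {k K₀ K₁ : Type} [Field k] [NumberField k] [IsCMField k] [Field K₀] [NumberField K₀] [IsCMField K₀]
  [Field K₁] [NumberField K₁] [IsCMField K₁] {N : ℕ}
  {E F₀ F₁ : AbelianVariety ℂ} {Ψ : CMType k} {Φ₀ : CMType K₀} {Φ₁ : CMType K₁}
  {ιE : 𝓞 k →+* End E} {θE : k →+* Module.End ℂ (complexBetti E.X 1)}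
  {ι₀ : 𝓞 K₀ →+* End F₀} {θ₀ : K₀ →+* Module.End ℂ (complexBetti F₀.X 1)}
  {ι₁ : 𝓞 K₁ →+* End F₁} {θ₁ : K₁ →+* Module.End ℂ (complexBetti F₁.X 1)}

omit [IsCMField k] in
/-- **A fivefold structure over a decic `K ⊇ i(k)` with two OR three members over `τ` can be replaced by one with exactly TWO members over `τ` on the SAME
variety** (three ↦ the conjugate structure along complex conjugation of `K`). [cite: Shimura1998, §18.2 Lemma (i)] -/
theorem exists_realisation_card_eq_two {K : Type} [Field K] [NumberField K] [IsCMField K] (h10 : Module.finrank ℚ K = 10) (h2 : Module.finrank ℚ k = 2)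
    (i : k →+* K) {F : AbelianVariety ℂ} {Φ : CMType K} {ι : 𝓞 K →+* End F} {θ : K →+* Module.End ℂ (complexBetti F.X 1)}
    (hF : IsCMTypeRealisation Φ F ι θ) (τ : k →+* ℂ)
    (h23 : (Finset.univ.filter fun s : K →+* ℂ => s.comp i = τ ∧ s ∈ Φ.1).card = 2 ∨
      (Finset.univ.filter fun s : K →+* ℂ => s.comp i = τ ∧ s ∈ Φ.1).card = 3) :
    ∃ (Φ' : CMType K) (ι' : 𝓞 K →+* End F) (θ' : K →+* Module.End ℂ (complexBetti F.X 1)),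
      IsCMTypeRealisation Φ' F ι' θ' ∧ (Finset.univ.filter fun s : K →+* ℂ => s.comp i = τ ∧ s ∈ Φ'.1).card = 2 := by
  rcases h23 with h | h
  · exact ⟨Φ, ι, θ, hF, h⟩
  · refine ⟨_, _, _, hF.transport (IsCMField.complexConj K).toRingEquiv, ?_⟩
    rw [SexticOcticWeil.card_filter_cmTypeMap_complexConj i τ Φ, SexticOcticWeil.card_filter_comp_eq_of_finrank (n := 5) i (by rw [h10]) h2 τ, h]

/-- **TWO WEIL-TYPE CM FIVEFOLDS OVER NON-ISOMORPHIC DECIC CM FIELDS CONTAINING `k` — `vec` form, given ONLY Markman's hyperbolic-sixfold theorem.**  `k` imaginary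
quadratic, `E ⊨ (k; Ψ)` a CM elliptic curve; `F_m ⊨ (K_m; Φ_m)` (`m = 0, 1`) abelian FIVEFOLDS with CM by DECIC CM fields `K_m ⊇ i_m(k)` whose types have TWO OR THREE
members over one (hence each) embedding of `k` (`k`-signature `(2,3)` or `(3,2)`: Weil type); `Hom(K₁, K₀) = ∅`.  Then for every `κ : Fin N → Fin 3` — every
`E^a × F₀^b × F₁^c` — every rational `(p,p)`-class on `⨁_j ![E, F₀, F₁] (κ j)` is algebraic, GIVEN ONLY `Markman2025_weilClasses_algebraic_hyperbolicSixfold`.  (The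
`(1,4)` fivefolds are NOT covered: their Weil classes live on eightfolds.)  `HC_CM` is NOT asserted. [cite: Markman2025SecantWeil, Thm 1.5.1]
[cite: Shimura1998, §18.2 Lemma (i)] [cite: Lang2002, V §1 Prop. 1.2, VI §1 Thm. 1.1] -/
theorem hodgeConjectureFor_biproduct_comp_vec_of_two_decics_of_isEmpty (hM6 : Markman2025_weilClasses_algebraic_hyperbolicSixfold)
    (h2 : Module.finrank ℚ k = 2) (h10₀ : Module.finrank ℚ K₀ = 10) (h10₁ : Module.finrank ℚ K₁ = 10) (i₀ : k →+* K₀) (i₁ : k →+* K₁)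
    (hE : IsCMTypeRealisation Ψ E ιE θE) (hF₀ : IsCMTypeRealisation Φ₀ F₀ ι₀ θ₀) (hF₁ : IsCMTypeRealisation Φ₁ F₁ ι₁ θ₁) {τ : k →+* ℂ} (hτΨ : τ ∈ Ψ.1)
    (h23₀ : (Finset.univ.filter fun s : K₀ →+* ℂ => s.comp i₀ = τ ∧ s ∈ Φ₀.1).card = 2 ∨
      (Finset.univ.filter fun s : K₀ →+* ℂ => s.comp i₀ = τ ∧ s ∈ Φ₀.1).card = 3)
    (h23₁ : (Finset.univ.filter fun s : K₁ →+* ℂ => s.comp i₁ = τ ∧ s ∈ Φ₁.1).card = 2 ∨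
      (Finset.univ.filter fun s : K₁ →+* ℂ => s.comp i₁ = τ ∧ s ∈ Φ₁.1).card = 3)
    (hK : IsEmpty (K₁ →+* K₀)) (κ : Fin N → Fin 3) :
    HodgeConjectureFor (⨁ fun j => (![E, F₀, F₁] : Fin 3 → AbelianVariety ℂ) (κ j)).dim
      (⨁ fun j => (![E, F₀, F₁] : Fin 3 → AbelianVariety ℂ) (κ j)).X := by
  obtain ⟨Φ₀', ι₀', θ₀', hF₀', h2₀⟩ := exists_realisation_card_eq_two h10₀ h2 i₀ hF₀ τ h23₀
  obtain ⟨Φ₁', ι₁', θ₁', hF₁', h2₁⟩ := exists_realisation_card_eq_two h10₁ h2 i₁ hF₁ τ h23₁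
  have hττ : ComplexEmbedding.conjugate τ ≠ τ := QuarticCM.conjugate_ne τ
  have hk : ∀ σ : k →+* ℂ, σ = τ ∨ σ = ComplexEmbedding.conjugate τ := fun σ => QuarticCM.eq_or_eq_conjugate_of_quadratic h2 τ σ
  have hΨ : ∀ σ : k →+* ℂ, σ ∈ Ψ.1 ↔ σ = τ := by
    intro σ
    rcases hk σ with rfl | rfl
    · exact ⟨fun _ => rfl, fun _ => hτΨ⟩
    · exact ⟨fun h => absurd h ((Ψ.2 τ).1 hτΨ), fun h => absurd h hττ⟩
  let Kf : Fin 3 → Type := Fin.cons k (Fin.cons K₀ (Fin.cons K₁ finZeroElim))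
  letI instF : ∀ j, Field (Kf j) := Fin.cons ‹Field k› (Fin.cons ‹Field K₀› (Fin.cons ‹Field K₁› finZeroElim))
  letI instN : ∀ j, NumberField (Kf j) := Fin.cons ‹NumberField k› (Fin.cons ‹NumberField K₀› (Fin.cons ‹NumberField K₁› finZeroElim))
  haveI instC : ∀ j, IsCMField (Kf j) := Fin.cons ‹IsCMField k› (Fin.cons ‹IsCMField K₀› (Fin.cons ‹IsCMField K₁› finZeroElim))
  let Φf : ∀ j : Fin 3, CMType (Kf (mfSlots (0 : Fin 3) Fin.succ j)) := Fin.cons Ψ (Fin.cons Φ₀' (Fin.cons Φ₁' finZeroElim))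
  let ιf : ∀ j : Fin 3, 𝓞 (Kf (mfSlots (0 : Fin 3) Fin.succ j)) →+* End ((![E, F₀, F₁] : Fin 3 → AbelianVariety ℂ) j) :=
    Fin.cons ιE (Fin.cons ι₀' (Fin.cons ι₁' finZeroElim))
  let θf : ∀ j : Fin 3, Kf (mfSlots (0 : Fin 3) Fin.succ j) →+* Module.End ℂ (complexBetti ((![E, F₀, F₁] : Fin 3 → AbelianVariety ℂ) j).X 1) :=
    Fin.cons θE (Fin.cons θ₀' (Fin.cons θ₁' finZeroElim))
  have hA : ∀ j, IsCMTypeRealisation (Φf j) ((![E, F₀, F₁] : Fin 3 → AbelianVariety ℂ) j) (ιf j) (θf j) :=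
    Fin.cons hE (Fin.cons hF₀' (Fin.cons hF₁' finZeroElim))
  let im : ∀ m : Fin 2, Kf 0 →+* Kf (Fin.succ m) := Fin.cons i₀ (Fin.cons i₁ finZeroElim)
  have h10 : ∀ m : Fin 2, Module.finrank ℚ (Kf (Fin.succ m)) = 10 := Fin.forall_fin_two.2 ⟨h10₀, h10₁⟩
  have h23 : ∀ m : Fin 2, (Finset.univ.filter fun s : Kf (Fin.succ m) →+* ℂ => s.comp (im m) = τ ∧ s ∈ (Φf m.succ).1).card = 2 :=
    Fin.forall_fin_two.2 ⟨h2₀, h2₁⟩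
  have hK' : IsEmpty (Kf (Fin.succ 1) →+* Kf (Fin.succ 0)) := hK
  exact hodgeConjectureFor_biproduct_comp_of_two_decics_of_isEmpty (Kf := Kf) (i₀ := (0 : Fin 3)) (is := Fin.succ)
    (A := (![E, F₀, F₁] : Fin 3 → AbelianVariety ℂ)) (Φ := Φf) (ι := ιf) (θ := θf) hM6 κ h2 h10 im hA hΨ h23 hK'

/-- **Dominated form**: every abelian variety dominated by a product of copies of `E`, `F₀`, `F₁` satisfies the Hodge conjecture, given only Markman's
hyperbolic-sixfold theorem. [cite: Markman2025SecantWeil, Thm 1.5.1] [cite: MumfordAV1970, §19 Thm. 1 and p. 169] -/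
theorem hodgeConjectureFor_of_avDominatedBy_comp_vec_of_two_decics_of_isEmpty (hM6 : Markman2025_weilClasses_algebraic_hyperbolicSixfold)
    (h2 : Module.finrank ℚ k = 2) (h10₀ : Module.finrank ℚ K₀ = 10) (h10₁ : Module.finrank ℚ K₁ = 10) (i₀ : k →+* K₀) (i₁ : k →+* K₁)
    (hE : IsCMTypeRealisation Ψ E ιE θE) (hF₀ : IsCMTypeRealisation Φ₀ F₀ ι₀ θ₀) (hF₁ : IsCMTypeRealisation Φ₁ F₁ ι₁ θ₁) {τ : k →+* ℂ} (hτΨ : τ ∈ Ψ.1)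
    (h23₀ : (Finset.univ.filter fun s : K₀ →+* ℂ => s.comp i₀ = τ ∧ s ∈ Φ₀.1).card = 2 ∨
      (Finset.univ.filter fun s : K₀ →+* ℂ => s.comp i₀ = τ ∧ s ∈ Φ₀.1).card = 3)
    (h23₁ : (Finset.univ.filter fun s : K₁ →+* ℂ => s.comp i₁ = τ ∧ s ∈ Φ₁.1).card = 2 ∨
      (Finset.univ.filter fun s : K₁ →+* ℂ => s.comp i₁ = τ ∧ s ∈ Φ₁.1).card = 3)
    (hK : IsEmpty (K₁ →+* K₀)) (κ : Fin N → Fin 3) {X : AbelianVariety ℂ}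
    (hX : Domination.AVDominatedBy X (⨁ fun j => (![E, F₀, F₁] : Fin 3 → AbelianVariety ℂ) (κ j))) : HodgeConjectureFor X.dim X.X :=
  Domination.hodgeConjectureFor_of_avDominatedBy
    (hodgeConjectureFor_biproduct_comp_vec_of_two_decics_of_isEmpty hM6 h2 h10₀ h10₁ i₀ i₁ hE hF₀ hF₁ hτΨ h23₀ h23₁ hK κ) hX

end Vec

end Summit.HodgeConjecture.CorCM.MultiFieldWeil

end
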